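import Literature.Analysis.FluidPDE.AxisymmetricL3OffTube
import Literature.Analysis.FluidPDE.AxisymmetricEuler
import HarnessLib

/-!
# Crux `AxisymSwirlRegular` (stmt-NavierStokesRegularity-1964), line `radial_inflow_split`,
# piece X₂ `AprioriRadialInflowBound`: the off-axis bound `S3` of its birth skeleton

`--supports stmt-NavierStokesRegularity-1964` (helper file; theorems only, no definitions).

The birth skeleton `Cruxes/AxisymSwirlRegular/Lines/AprioriRadialInflowBound_birth.lean` of the piece
X₂ (route item stmt-NavierStokesRegularity-19060) reduces the a-priori one-sided radial inflow bound to
three statements S1 (cyclostrophic defect floor, open), S2 (radial-momentum minimum principle) and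
S3 (boundedness off every axis tube up to the final time). This file proves **S3 verbatim**
(`offAxisBound`): in the standing class (classical on `[0,T)`, Leray–Hopf on `[0,T]` from `u 0`,
bounded on sub-slabs, axisymmetric slices; the rapid decay of the datum is not used) the velocity is
bounded on `{cylRadius ≥ δ₀} × [0,T)` for every `δ₀ > 0`.

Proof: the standing class is the tree's `AxisymmetricL3Hyp`; near the final time the bound is
`AxisymmetricL3Hyp.bounded_offTube` (every off-axis point `(T,x₀)` is a point of local boundedness —
Caffarelli–Kohn–Nirenberg / Seregin's criterion — and `u` is bounded near `T` outside a large ball,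
glued by compactness), below it the sub-slab bound.

References: L. Caffarelli, R. Kohn, L. Nirenberg, Comm. Pure Appl. Math. 35 (1982), Thm. B;
G. Seregin, V. Šverák, Comm. PDE 34 (2009) = arXiv:0804.1803, §3 (p. 9).
-/

noncomputable section

open Literature.Analysis.FluidPDE Set

namespace Summit.NavierStokesRegularity.NavierStokesRegularity.Theorems

-- the problem directory repeats the summit name (`NavierStokesRegularity/NavierStokesRegularity`)
set_option linter.dupNamespace false

/-- **S3 of the birth skeleton of `AprioriRadialInflowBound` (stmt-…-19060), verbatim: boundedness off
every axis tube up to the final time.** In the standing class of the crux `AxisymSwirlRegular`, for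
every `δ₀ > 0` there is `M` with `‖u t x‖ ≤ M` for all `t ∈ [0,T)` and all `x` with `cylRadius x ≥ δ₀`.
Near `T`: `AxisymmetricL3Hyp.bounded_offTube` (off-axis points of the final time are regular, CKN;
far field bounded near `T`); before: the sub-slab bound. -/
theorem offAxisBound :
    ∀ (ν T : ℝ), 0 < ν → 0 < T → ∀ (u : ℝ → EuclideanSpace ℝ (Fin 3) → EuclideanSpace ℝ (Fin 3)) (p : ℝ → EuclideanSpace ℝ (Fin 3) → ℝ), Literature.Analysis.FluidPDE.IsClassicalNSSolutionOn (Set.Ico 0 T) ν 0 u p → Literature.Analysis.FluidPDE.IsLerayHopfOn T ν 0 (u 0) u → (∀ T' < T, ∃ M : ℝ, ∀ t ∈ Set.Icc 0 T', ∀ x, ‖u t x‖ ≤ M) → (∀ t ∈ Set.Ico 0 T, Literature.Analysis.FluidPDE.IsAxisymmetric (u t)) → Literature.Analysis.FluidPDE.HasRapidSpatialDecay (u 0) → ∀ δ₀ : ℝ, 0 < δ₀ → ∃ M : ℝ, ∀ t ∈ Set.Ico 0 T, ∀ x, δ₀ ≤ Literature.Analysis.FluidPDE.cylRadius x → ‖u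 t x‖ ≤ M := by
  intro ν T hν hT u p hcl hLH hbd hax _ δ₀ hδ₀
  have H : AxisymmetricL3Hyp ν T u p := ⟨hν, hT, hcl, hLH, hbd, hax⟩
  obtain ⟨r₀, hr₀, M₀, hM₀⟩ := H.bounded_offTube hδ₀
  obtain ⟨M₁, hM₁⟩ := hbd (T - r₀ ^ 2 / 2) (by nlinarith)
  refine ⟨max M₀ M₁, fun t ht x hx => ?_⟩
  by_cases htop : T - r₀ ^ 2 < t
  · exact (hM₀ t ⟨htop, ht.2⟩ x hx).trans (le_max_left _ _)
  · have ht' : t ∈ Icc 0 (T - r₀ ^ 2 / 2) := ⟨ht.1, by push Not at htop; nlinarith⟩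
    exact (hM₁ t ht' x).trans (le_max_right _ _)

end Summit.NavierStokesRegularity.NavierStokesRegularity.Theorems

end
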